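import Summits.ABC.StewartYu.MatveevCramerRelation
import Summits.ABC.StewartYu.MatveevLeverMatrix
import HarnessLib

/-!
# Cell abc-stewartyu, Gen-3 frames: a non-singular minor THROUGH A PRESCRIBED COLUMN, and the Cramer integer
# relation with weighted Hadamard bounds on a GIVEN minor (Nesterenko 2003, Prop. 2.6 (2.9)–(2.12))

`Summits/ABC/StewartYu/MatveevCramerMinor.lean` — cell `abc-stewartyu` (HOME `run/shared/lean/pub/abc-stewartyu/`),
route `YuMatveevShapeRat` (rung A1.L, crux r2 `ArchCoreRat`, stmt-ABC-20502), seat p4 (g9), parcel WP-L.A P-A1.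
Theorems only; place-free linear algebra (sequel of `MatveevCramerRelation.lean`, lit seat g5).

In Matveev's step in the PIVOT-WEIGHTED currency (`GenThreeStepArchW.lean`; Matveev 2000 (1.3), lit WP-LA-SPEC
§17) the Cramer minor of the re-based basis `Z` must pass THROUGH the pivot column `k₀` (print, p. 58: «the number
`A = max Aᵢ` is contained in `{A₁,…,A_ν}`», there with the pivot at the maximal weight), so that `∏A_κ ≥ A_{k₀}`.
`LatticeLever.exists_int_relation_weighted` chooses its own minor; here the minor is an INPUT:

* `exists_minor_through`: if the integer rows `Z₁,…,Z_r` are independent and column `k₀` of `Z` is non-zero, some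
  non-singular `r × r` minor of `Z` has `k₀` among its columns (exchange argument: write column `k₀` in the basis of
  the columns of any non-singular minor, `Matrix.det_updateRow_sum`);
* `exists_int_relation_weighted_of_minor`: for `b ∈ span_ℚ(Z)` and an injective `κ` with `det (Z_j(κ_i)) ≠ 0`:
  `m₀ b = ∑ mᵢ Zᵢ`, `m₀ ≠ 0`, `|m₀|·∏A_κ ≤ ∏‖Zᵢ‖_A`, `|mⱼ|·∏A_κ ≤ (∑ᵢ A_{κi}|b_{κi}|)·∏_{i≠j}‖Zᵢ‖_A`
  (proof adapted verbatim from `exists_int_relation_weighted`).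

References: Yu. V. Nesterenko, LNM 1819 (2003), proof of Prop. 2.6, (2.9)–(2.12) (pp. 57–58).
-/

noncomputable section

open Finset
open scoped Matrix

namespace Summit.ABC.StewartYu.LatticeLever

variable {n r : ℕ}

/-! ### A non-singular minor through a prescribed non-zero column -/

/-- **Exchange lemma**: if the integer rows `Z₁,…,Z_r ∈ ℤⁿ` are linearly independent and column `k₀` of `Z` is
non-zero, there is a non-singular `r × r` minor of `Z` whose column set contains `k₀` (start from any
non-singular minor; if it avoids `k₀`, write column `k₀` in the basis of its columns and exchange it against a
column with a non-zero coefficient). [cite: Nesterenko2003, proof of Prop 2.6, p. 58 («A ∈ {A₁,…,A_ν}» WLOG)] -/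
theorem exists_minor_through (Z : Fin r → Fin n → ℤ) (hZ : LinearIndependent ℤ Z) (k₀ : Fin n)
    (hk₀ : ∃ i, Z i k₀ ≠ 0) :
    ∃ κ : Fin r → Fin n, Function.Injective κ ∧ (∃ i, κ i = k₀) ∧
      (Matrix.of fun i j => Z j (κ i)).det ≠ 0 := by
  classical
  obtain ⟨κ₁, hκ₁, hdet₁⟩ :=
    Summit.ABC.StewartYu.MatveevLever.exists_cols_det_ne_zero (Matrix.of Z) hZ
  -- the transposed orientation
  have hdet₁' : (Matrix.of fun i j => Z j (κ₁ i)).det ≠ 0 := by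
    have : (Matrix.of fun i j => Z j (κ₁ i)) = ((Matrix.of Z).submatrix id κ₁).transpose := by
      ext i j; rfl
    rw [this, Matrix.det_transpose]; exact hdet₁
  by_cases hmem : ∃ i, κ₁ i = k₀
  · exact ⟨κ₁, hκ₁, hmem, hdet₁'⟩
  push Not at hmem
  -- over `ℚ`
  set AZ : Matrix (Fin r) (Fin r) ℤ := Matrix.of fun i j => Z j (κ₁ i) with hAZ
  set Aq : Matrix (Fin r) (Fin r) ℚ := AZ.map (fun x : ℤ => (x : ℚ)) with hAq
  have hAqdet : Aq.det ≠ 0 := by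
    rw [hAq, ← Int.cast_det]
    exact_mod_cast hdet₁'
  have hAqTdet : IsUnit (Aqᵀ).det := by
    rw [Matrix.det_transpose, isUnit_iff_ne_zero]; exact hAqdet
  set w : Fin r → ℚ := fun j => (Z j k₀ : ℚ) with hw
  have hw0 : w ≠ 0 := by
    obtain ⟨i, hi⟩ := hk₀
    intro h0
    have := congrFun h0 i
    simp only [hw, Pi.zero_apply, Int.cast_eq_zero] at this
    exact hi this
  -- `w` in the basis of the rows of `Aq`
  set c : Fin r → ℚ := (Aqᵀ)⁻¹ *ᵥ w with hc
  have hAc : (Aqᵀ) *ᵥ c = w := by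
    rw [hc, Matrix.mulVec_mulVec, Matrix.mul_nonsing_inv _ hAqTdet, Matrix.one_mulVec]
  have hsum : (∑ k, c k • Aq k) = w := by
    funext j
    have h1 := congrFun hAc j
    simp only [Matrix.mulVec, dotProduct, Matrix.transpose_apply] at h1
    simp only [Finset.sum_apply, Pi.smul_apply, smul_eq_mul]
    rw [← h1]
    exact Finset.sum_congr rfl fun k _ => mul_comm _ _
  have hc0 : c ≠ 0 := by
    intro h0; apply hw0
    rw [← hAc, h0, Matrix.mulVec_zero]
  obtain ⟨i₁, hi₁⟩ : ∃ i, c i ≠ 0 := by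
    by_contra h; push Not at h; exact hc0 (funext h)
  -- exchange row `i₁` against `w`
  have hdet₂ : (Aq.updateRow i₁ w).det ≠ 0 := by
    rw [← hsum, Matrix.det_updateRow_sum, smul_eq_mul]
    exact mul_ne_zero hi₁ hAqdet
  set κ : Fin r → Fin n := Function.update κ₁ i₁ k₀ with hκdef
  have hκk₀ : κ i₁ = k₀ := by simp [hκdef]
  have hκne : ∀ i, i ≠ i₁ → κ i = κ₁ i := fun i hi => by simp [hκdef, hi]
  refine ⟨κ, ?_, ⟨i₁, hκk₀⟩, ?_⟩
  · intro i i' h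
    by_cases hi : i = i₁
    · by_cases hi' : i' = i₁
      · rw [hi, hi']
      · rw [hi, hκk₀, hκne i' hi'] at h
        exact absurd h.symm (hmem i')
    · by_cases hi' : i' = i₁
      · rw [hi', hκk₀, hκne i hi] at h
        exact absurd h (hmem i)
      · rw [hκne i hi, hκne i' hi'] at h
        exact hκ₁ h
  · -- the new minor is `Aq.updateRow i₁ w`, up to the cast
    have hM : (Matrix.of fun i j => Z j (κ i)).map (fun x : ℤ => (x : ℚ)) = Aq.updateRow i₁ w := by
      ext i j
      by_cases hi : i = i₁
      · subst hi
        simp [hκk₀, hw]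
      · simp [Matrix.updateRow_ne hi, hκne i hi, hAq, hAZ]
    intro h0
    apply hdet₂
    rw [← hM, ← Int.cast_det, h0, Int.cast_zero]

/-! ### The Cramer relation on a given minor -/

/-- **The Cramer integer relation with weighted Hadamard bounds, on a GIVEN non-singular minor `κ`** (the tree's
`LatticeLever.exists_int_relation_weighted` with the minor prescribed instead of chosen): for integer rows `zᵢ`,
`b ∈ span_ℚ(z)`, positive weights `A` and an injective `κ` with `det(z_j(κ_i)) ≠ 0`, there are `m₀ ≠ 0` and `m`
with `m₀ b = ∑ mᵢ zᵢ`, `|m₀|·∏A_κ ≤ ∏‖zᵢ‖_A` and `|mⱼ|·∏A_κ ≤ (∑ᵢ A_{κi}|b_{κi}|)·∏_{i≠j}‖zᵢ‖_A`.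
[cite: Nesterenko2003, Prop 2.6 proof (2.9)-(2.12) (pp. 57-58)] -/
theorem exists_int_relation_weighted_of_minor {A : Fin n → ℝ} (hA : ∀ k, 0 < A k)
    (z : Fin r → Fin n → ℤ) (b : Fin n → ℤ)
    (hb : (fun k => (b k : ℚ)) ∈ Submodule.span ℚ (Set.range fun i => fun k => (z i k : ℚ)))
    (κ : Fin r → Fin n) (hκ : Function.Injective κ) (hdetB : (Matrix.of fun i j => z j (κ i)).det ≠ 0) :
    ∃ (m₀ : ℤ) (m : Fin r → ℤ), m₀ ≠ 0 ∧
      (∀ k, m₀ * b k = ∑ i, m i * z i k) ∧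
      (|m₀| : ℝ) * ∏ i, A (κ i) ≤ ∏ i, (∑ k, A k * |(z i k : ℝ)|) ∧
      ∀ j, (|m j| : ℝ) * ∏ i, A (κ i) ≤
        (∑ i, A (κ i) * |(b (κ i) : ℝ)|) * ∏ i ∈ univ.erase j, (∑ k, A k * |(z i k : ℝ)|) := by
  -- adapted from Summits/ABC/StewartYu/MatveevCramerRelation.lean (`exists_int_relation_weighted`)
  classical
  set B : Matrix (Fin r) (Fin r) ℤ := Matrix.of fun i j => z j (κ i) with hB
  have hBq : (B.map (Int.castRingHom ℚ)).det ≠ 0 := by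
    have : B.map (Int.castRingHom ℚ) = B.map (fun x : ℤ => (x : ℚ)) := by ext i j; simp
    rw [this, ← Int.cast_det]
    exact_mod_cast hdetB
  -- Cramer
  set bv : Fin r → ℤ := fun i => b (κ i) with hbv
  set x : Fin r → ℤ := B.cramer bv with hx
  have hBx : B *ᵥ x = B.det • bv := Matrix.mulVec_cramer B bv
  -- the span coefficients over `ℚ` and uniqueness on the selected coordinates
  obtain ⟨c, hc⟩ : ∃ c : Fin r → ℚ, ∑ i, c i • (fun k => (z i k : ℚ)) = fun k => (b k : ℚ) :=
    (Submodule.mem_span_range_iff_exists_fun ℚ).mp hb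
  have hc' : ∀ k, ∑ i, c i * (z i k : ℚ) = b k := by
    intro k
    have := congrFun hc k
    simpa only [Finset.sum_apply, Pi.smul_apply, smul_eq_mul] using this
  have hxc : ∀ i, (x i : ℚ) = B.det * c i := by
    have hinj : Function.Injective (B.map (Int.castRingHom ℚ)).mulVec := by
      rw [Matrix.mulVec_injective_iff_isUnit, Matrix.isUnit_iff_isUnit_det, isUnit_iff_ne_zero]
      exact hBq
    have h1 : (B.map (Int.castRingHom ℚ)).mulVec (fun i => (x i : ℚ)) =
        fun i => ((B.det : ℤ) : ℚ) * (bv i : ℚ) := by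
      funext i
      have := congrFun hBx i
      simp only [Matrix.mulVec, dotProduct, Pi.smul_apply, smul_eq_mul] at this ⊢
      simp only [Matrix.map_apply, Int.coe_castRingHom]
      exact_mod_cast this
    have h2 : (B.map (Int.castRingHom ℚ)).mulVec (fun i => (B.det : ℚ) * c i) =
        fun i => ((B.det : ℤ) : ℚ) * (bv i : ℚ) := by
      funext i
      simp only [Matrix.mulVec, dotProduct, Matrix.map_apply, Int.coe_castRingHom, hB, hbv,
        Matrix.of_apply]
      rw [← hc' (κ i), Finset.mul_sum]
      refine Finset.sum_congr rfl fun j _ => ?_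
      ring
    have := hinj (h1.trans h2.symm)
    intro i
    exact congrFun this i
  -- the relation on ALL coordinates
  have hrel : ∀ k, B.det * b k = ∑ i, x i * z i k := by
    intro k
    have hq : ((B.det : ℤ) : ℚ) * (b k : ℚ) = ∑ i, (x i : ℚ) * (z i k : ℚ) := by
      rw [← hc' k, Finset.mul_sum]
      refine Finset.sum_congr rfl fun i _ => ?_
      rw [hxc i]; ring
    exact_mod_cast hq
  -- weighted Hadamard bounds
  set BR : Matrix (Fin r) (Fin r) ℝ := Matrix.of fun i j => (z j (κ i) : ℝ) with hBR
  have hBRdet : BR.det = (B.det : ℝ) := by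
    have : BR = B.map (Int.castRingHom ℝ) := by ext i j; rfl
    rw [this, ← RingHom.mapMatrix_apply, ← RingHom.map_det]; rfl
  have hnormle : ∀ j, ∑ i, A (κ i) * |(z j (κ i) : ℝ)| ≤ ∑ k, A k * |(z j k : ℝ)| := fun j =>
    sum_comp_le_sum_of_injective_real hκ (fun k => A k * |(z j k : ℝ)|)
      fun k => mul_nonneg (hA k).le (abs_nonneg _)
  have hm₀ : (|B.det| : ℝ) * ∏ i, A (κ i) ≤ ∏ i, (∑ k, A k * |(z i k : ℝ)|) := by
    have h := abs_det_mul_prod_le BR (fun i => A (κ i)) fun i => hA _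
    rw [hBRdet] at h
    refine h.trans (Finset.prod_le_prod (fun j _ => Finset.sum_nonneg fun i _ =>
      mul_nonneg (hA _).le (abs_nonneg _)) fun j _ => ?_)
    simpa [hBR] using hnormle j
  have hmj : ∀ j, (|x j| : ℝ) * ∏ i, A (κ i) ≤
      (∑ i, A (κ i) * |(b (κ i) : ℝ)|) * ∏ i ∈ univ.erase j, (∑ k, A k * |(z i k : ℝ)|) := by
    intro j
    have hxj : x j = (B.updateCol j bv).det := by rw [hx, Matrix.cramer_apply]
    set BRj : Matrix (Fin r) (Fin r) ℝ := Matrix.of fun i j' => ((B.updateCol j bv) i j' : ℝ) with hBRj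
    have hBRjdet : BRj.det = ((B.updateCol j bv).det : ℝ) := by
      have : BRj = (B.updateCol j bv).map (Int.castRingHom ℝ) := by ext i j'; rfl
      rw [this, ← RingHom.mapMatrix_apply, ← RingHom.map_det]; rfl
    have h := abs_det_mul_prod_le BRj (fun i => A (κ i)) fun i => hA _
    rw [hBRjdet, ← hxj] at h
    refine h.trans ?_
    rw [← Finset.mul_prod_erase univ _ (mem_univ j)]
    refine mul_le_mul ?_ (Finset.prod_le_prod (fun j' _ => Finset.sum_nonneg fun i _ =>
      mul_nonneg (hA _).le (abs_nonneg _)) fun j' hj' => ?_)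
      (Finset.prod_nonneg fun j' _ => Finset.sum_nonneg fun i _ => mul_nonneg (hA _).le (abs_nonneg _))
      (Finset.sum_nonneg fun i _ => mul_nonneg (hA _).le (abs_nonneg _))
    · refine le_of_eq (Finset.sum_congr rfl fun i _ => ?_)
      simp [hBRj, Matrix.updateCol_self, hbv]
    · have hne : j' ≠ j := ne_of_mem_erase hj'
      calc ∑ i, A (κ i) * |BRj i j'| = ∑ i, A (κ i) * |(z j' (κ i) : ℝ)| := by
            refine Finset.sum_congr rfl fun i _ => ?_
            simp [hBRj, Matrix.updateCol_ne hne, hB]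
        _ ≤ ∑ k, A k * |(z j' k : ℝ)| := hnormle j'
  exact ⟨B.det, x, hdetB, hrel, hm₀, hmj⟩


end Summit.ABC.StewartYu.LatticeLever

end
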